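import Mathlib
import Literature.Probability.LatticeModels.LatticeGraph
import Literature.Probability.Process.StableLikeJumpChain
import HarnessLib

/-!
# TwoPointSpineGlue (route PrecisionLaplacian, item stmt-CriticalPhenomena-4805) — the walk bridge

Helper file 2/4.  For a probability mass function `q ≥ 0` on `ℤ³` (`HasSum q 1`) let
`p_n(x,y) = jumpChainProb (fun a b => q (b - a)) n x y` be the `n`-step laws of the random walk with
step law `q` (the tree's Chapman–Kolmogorov recursion of `StableLikeJumpChain.lean`, whose rows here sum
to `1`).  We prove:

* `jumpChainProb_succ`, `jumpChainProb_nonneg`, `hasSum_jumpChainProb`: the recursion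
  `p_{n+1}(x,y) = ∑_z p_n(x,z) q(y-z)`, nonnegativity and unit mass (Fubini for nonnegative double
  series);
* `renewal_iterate`: a bounded nonnegative solution of the renewal (Ornstein–Zernike) identity
  `G = A⁻¹ δ₀ + q * G` satisfies `G x = A⁻¹ ∑_{n<N} p_n(0,x) + ∑_z p_N(0,z) G(x-z)` for all `N`;
* `renewal_remainder_tendsto_zero`: the remainder vanishes as `N → ∞` when `G → 0` at infinity and
  `p_N(0,z) → 0` for each `z`;
* `eq_green_of_renewal` (**the bridge**): hence `G = A⁻¹ ∑_n p_n(0,·)`, i.e. `G` is `A⁻¹` times the Green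
  function of the (transient) walk.

This is the step "PrecisionIsLaplacian gives `G = A₀⁻¹ Σ q^{*n}`" of the item's informal proof
(the Green function of a transient walk as the bounded solution of the renewal equation vanishing at
infinity), in elementary form.  No new definitions.
-/

noncomputable section

namespace Summit.CriticalPhenomena.Ising3DConformalLimit.Theorems.SpineGlue

open Filter Topology
open Literature.Probability.LatticeModels Literature.Probability.Process

variable {q : Site 3 → ℝ}

/-- Translation invariance of sums over `ℤ³`. -/
theorem tsum_sub_right (f : Site 3 → ℝ) (z : Site 3) : ∑' w, f (w - z) = ∑' w, f w :=
  (Equiv.subRight z).tsum_eq f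

/-- One-step recursion of the walk with step law `q`: `p_{n+1}(x,y) = ∑_z p_n(x,z) q(y-z)`. -/
theorem jumpChainProb_succ (hq1 : HasSum q 1) (n : ℕ) (x y : Site 3) :
    jumpChainProb (fun a b => q (b - a)) (n + 1) x y =
      ∑' z, jumpChainProb (fun a b => q (b - a)) n x z * q (y - z) := by
  rw [jumpChainProb]
  refine tsum_congr fun z => ?_
  rw [tsum_sub_right q z, hq1.tsum_eq, div_one]

/-- The `0`-step law is the point mass at the start. -/
theorem jumpChainProb_zero' (x y : Site 3) :
    jumpChainProb (fun a b => q (b - a)) 0 x y = if x = y then 1 else 0 := by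
  rw [jumpChainProb]

/-- Nonnegativity and unit mass of the `n`-step laws. -/
theorem jumpChainProb_nonneg_hasSum (hq0 : ∀ x, 0 ≤ q x) (hq1 : HasSum q 1) :
    ∀ n (x : Site 3), (∀ y, 0 ≤ jumpChainProb (fun a b => q (b - a)) n x y) ∧
      HasSum (fun y => jumpChainProb (fun a b => q (b - a)) n x y) 1
  | 0, x => by
    refine ⟨fun y => ?_, ?_⟩
    · rw [jumpChainProb_zero']; split_ifs <;> norm_num
    · have : (fun y => jumpChainProb (fun a b => q (b - a)) 0 x y) =
          fun y => if y = x then 1 else 0 := by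
        funext y; rw [jumpChainProb_zero']; simp only [eq_comm]
      rw [this]; exact hasSum_ite_eq x 1
  | n + 1, x => by
    obtain ⟨hnn, hsum⟩ := jumpChainProb_nonneg_hasSum hq0 hq1 n x
    set p := jumpChainProb (fun a b => q (b - a)) with hp
    -- the nonnegative double family `f (z, y) = p n x z * q (y - z)`
    set f : Site 3 × Site 3 → ℝ := fun zy => p n x zy.1 * q (zy.2 - zy.1) with hf
    have hf0 : 0 ≤ f := fun zy => mul_nonneg (hnn _) (hq0 _)
    have hfib : ∀ z, HasSum (fun y => f (z, y)) (p n x z) := by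
      intro z
      have h := (((Equiv.subRight z).hasSum_iff).2 hq1).mul_left (p n x z)
      simpa [f, mul_one] using h
    have hfS : Summable f := by
      refine (summable_prod_of_nonneg hf0).2 ⟨fun z => (hfib z).summable, ?_⟩
      simp_rw [fun z => (hfib z).tsum_eq]
      exact hsum.summable
    have htot : HasSum f 1 := by
      have h1 : HasSum (fun z => p n x z) (∑' zy, f zy) := hfS.hasSum.prod_fiberwise hfib
      have h2 : ∑' zy, f zy = 1 := h1.unique hsum
      rw [← h2]
      exact hfS.hasSum
    -- swap the coordinates
    have hfS' : Summable (fun yz : Site 3 × Site 3 => f yz.swap) := hfS.prod_symm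
    have htot' : HasSum (fun yz : Site 3 × Site 3 => f yz.swap) 1 :=
      (Equiv.prodComm (Site 3) (Site 3)).hasSum_iff.2 htot
    have hrec : ∀ y, p (n + 1) x y = ∑' z, f (z, y) := fun y => by
      rw [hp, jumpChainProb_succ hq1]
    refine ⟨fun y => ?_, ?_⟩
    · rw [hrec]; exact tsum_nonneg fun z => hf0 _
    · have hfib' : ∀ y, HasSum (fun z => f (z, y)) (p (n + 1) x y) := by
        intro y
        rw [hrec]
        exact (hfS'.prod_factor y).hasSum
      exact htot'.prod_fiberwise hfib'

/-- The `n`-step laws are nonnegative. -/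
theorem jumpChainProb_nonneg (hq0 : ∀ x, 0 ≤ q x) (hq1 : HasSum q 1) (n : ℕ) (x y : Site 3) :
    0 ≤ jumpChainProb (fun a b => q (b - a)) n x y :=
  (jumpChainProb_nonneg_hasSum hq0 hq1 n x).1 y

/-- The `n`-step laws are probability vectors. -/
theorem hasSum_jumpChainProb (hq0 : ∀ x, 0 ≤ q x) (hq1 : HasSum q 1) (n : ℕ) (x : Site 3) :
    HasSum (fun y => jumpChainProb (fun a b => q (b - a)) n x y) 1 :=
  (jumpChainProb_nonneg_hasSum hq0 hq1 n x).2

/-- **Iterated renewal identity.** If `G = A⁻¹ δ₀ + q * G` with `G ≥ 0` bounded, then for every `N`,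
`G x = A⁻¹ ∑_{n<N} p_n(0,x) + ∑_z p_N(0,z) G(x - z)`. -/
theorem renewal_iterate (hq0 : ∀ x, 0 ≤ q x) (hq1 : HasSum q 1) {G : Site 3 → ℝ} {A B : ℝ}
    (hG0 : ∀ x, 0 ≤ G x) (hGB : ∀ x, G x ≤ B)
    (hid : ∀ z, G z = A⁻¹ * (if z = 0 then 1 else 0) + ∑' y, q y * G (z - y)) :
    ∀ (N : ℕ) (x : Site 3), G x =
      A⁻¹ * ∑ n ∈ Finset.range N, jumpChainProb (fun a b => q (b - a)) n 0 x +
        ∑' z, jumpChainProb (fun a b => q (b - a)) N 0 z * G (x - z) := by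
  set p := jumpChainProb (fun a b => q (b - a)) with hp
  intro N
  induction N with
  | zero =>
    intro x
    simp only [Finset.range_zero, Finset.sum_empty, mul_zero, zero_add]
    have : (fun z => p 0 0 z * G (x - z)) = fun z => if z = 0 then G x else 0 := by
      funext z; rw [hp, jumpChainProb_zero']
      by_cases h : z = 0
      · simp [h]
      · simp [h, Ne.symm h]
    rw [this, tsum_ite_eq]
  | succ N ih =>
    intro x
    have hnn := jumpChainProb_nonneg hq0 hq1 N (0 : Site 3)
    have hsum := hasSum_jumpChainProb hq0 hq1 N (0 : Site 3)
    -- `S z = ∑_y q y G(x - z - y)`, the convolution term of the renewal identity at `x - z`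
    set S : Site 3 → ℝ := fun z => ∑' y, q y * G (x - z - y) with hS
    have hqs : ∀ z, Summable fun y => q y * G (x - z - y) := fun z =>
      Summable.of_nonneg_of_le (fun y => mul_nonneg (hq0 _) (hG0 _))
        (fun y => mul_le_mul_of_nonneg_left (hGB _) (hq0 _)) (hq1.summable.mul_right B)
    have hS0 : ∀ z, 0 ≤ S z := fun z => tsum_nonneg fun y => mul_nonneg (hq0 _) (hG0 _)
    have hSB : ∀ z, S z ≤ B := fun z => by
      calc S z ≤ ∑' y, q y * B := (hqs z).tsum_le_tsum
              (fun y => mul_le_mul_of_nonneg_left (hGB _) (hq0 _)) (hq1.summable.mul_right B)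
        _ = B := by rw [tsum_mul_right, hq1.tsum_eq, one_mul]
    -- the double family `g (z, y) = p N 0 z * (q (y - z) * G (x - y))`
    set g : Site 3 × Site 3 → ℝ := fun zy => p N 0 zy.1 * (q (zy.2 - zy.1) * G (x - zy.2)) with hg
    have hg0 : 0 ≤ g := fun zy => mul_nonneg (hnn _) (mul_nonneg (hq0 _) (hG0 _))
    have hfibz : ∀ z, HasSum (fun y => g (z, y)) (p N 0 z * S z) := by
      intro z
      have h1 : HasSum (fun y => q (y - z) * G (x - y)) (S z) := by
        have h := (Equiv.subRight z).hasSum_iff.2 (hqs z).hasSum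
        convert h using 1
        funext y
        simp only [Function.comp_apply, Equiv.subRight_apply, sub_sub_sub_cancel_right]
      exact h1.mul_left (p N 0 z)
    have hgS : Summable g := by
      refine (summable_prod_of_nonneg hg0).2 ⟨fun z => (hfibz z).summable, ?_⟩
      simp_rw [fun z => (hfibz z).tsum_eq]
      exact Summable.of_nonneg_of_le (fun z => mul_nonneg (hnn _) (hS0 _))
        (fun z => mul_le_mul_of_nonneg_left (hSB _) (hnn _)) (hsum.summable.mul_right B)
    have hgS' : Summable (fun yz : Site 3 × Site 3 => g yz.swap) := hgS.prod_symm
    -- fibres in `y`: `∑_z p N 0 z q(y-z) G(x-y) = p (N+1) 0 y G(x-y)`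
    have hfiby : ∀ y, HasSum (fun z => g (z, y)) (p (N + 1) 0 y * G (x - y)) := by
      intro y
      have h := (hgS'.prod_factor y).hasSum
      have hval : ∑' z, g (z, y) = p (N + 1) 0 y * G (x - y) := by
        rw [hp, jumpChainProb_succ hq1, ← tsum_mul_right]
        refine tsum_congr fun z => ?_
        simp only [g]; ring
      rw [← hval]
      exact h
    have hswap : ∑' z, p N 0 z * S z = ∑' y, p (N + 1) 0 y * G (x - y) := by
      have h1 : HasSum (fun z => p N 0 z * S z) (∑' zy, g zy) := hgS.hasSum.prod_fiberwise hfibz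
      have h2 : HasSum (fun y => p (N + 1) 0 y * G (x - y)) (∑' yz : Site 3 × Site 3, g yz.swap) :=
        hgS'.hasSum.prod_fiberwise hfiby
      rw [h1.tsum_eq, h2.tsum_eq]
      exact ((Equiv.prodComm (Site 3) (Site 3)).tsum_eq g).symm
    -- expand `G (x - z)` by the renewal identity inside the remainder
    have hstep : ∑' z, p N 0 z * G (x - z) = A⁻¹ * p N 0 x + ∑' y, p (N + 1) 0 y * G (x - y) := by
      have hexp : (fun z => p N 0 z * G (x - z)) =
          fun z => (if z = x then A⁻¹ * p N 0 x else 0) + p N 0 z * S z := by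
        funext z
        rw [hid (x - z)]
        by_cases h : z = x
        · subst h; simp [S]; ring
        · have : x - z ≠ 0 := sub_ne_zero.2 (Ne.symm h)
          simp [S, h, this]
      have hsum1 : Summable fun z : Site 3 => if z = x then A⁻¹ * p N 0 x else 0 :=
        (hasSum_ite_eq x _).summable
      have hsum2 : Summable fun z => p N 0 z * S z := (hgS.hasSum.prod_fiberwise hfibz).summable
      rw [hexp, hsum1.tsum_add hsum2, tsum_ite_eq, hswap]
    rw [ih x, hstep, Finset.sum_range_succ, mul_add]
    ring

/-- The remainder `∑_z p_N(0,z) G(x-z)` tends to `0` when `G → 0` at infinity and each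
`p_N(0,z) → 0` (transience). -/
theorem renewal_remainder_tendsto_zero (hq0 : ∀ x, 0 ≤ q x) (hq1 : HasSum q 1)
    {G : Site 3 → ℝ} {B : ℝ} (hG0 : ∀ x, 0 ≤ G x) (hGB : ∀ x, G x ≤ B)
    (hGinf : Tendsto G cofinite (𝓝 0))
    (htrans : ∀ z, Tendsto (fun N => jumpChainProb (fun a b => q (b - a)) N 0 z) atTop (𝓝 0))
    (x : Site 3) :
    Tendsto (fun N => ∑' z, jumpChainProb (fun a b => q (b - a)) N 0 z * G (x - z)) atTop (𝓝 0) := by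
  set p := jumpChainProb (fun a b => q (b - a)) with hp
  have hB : 0 ≤ B := le_trans (hG0 0) (hGB 0)
  rw [Metric.tendsto_atTop]
  intro ε hε
  -- the finite set where `G (x - z)` is not small
  have hsmall : ∀ᶠ w in cofinite, G w < ε / 2 :=
    (hGinf.eventually (gt_mem_nhds (half_pos hε)))
  have hfin : Set.Finite {z : Site 3 | ε / 2 ≤ G (x - z)} := by
    have h1 : Set.Finite {w : Site 3 | ε / 2 ≤ G w} := by
      have : {w : Site 3 | ε / 2 ≤ G w} = {w | G w < ε / 2}ᶜ := by ext w; simp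
      rw [this]; exact hsmall
    have : {z : Site 3 | ε / 2 ≤ G (x - z)} = (fun z => x - z) ⁻¹' {w | ε / 2 ≤ G w} := rfl
    rw [this]
    exact h1.preimage (sub_right_injective.injOn)
  set T : Finset (Site 3) := hfin.toFinset with hT
  -- on `T` the finitely many `p N 0 z` tend to `0`
  have hT0 : Tendsto (fun N => ∑ z ∈ T, p N 0 z) atTop (𝓝 0) := by
    have := tendsto_finsetSum T fun z _ => htrans z
    simpa using this
  have hT1 : ∀ᶠ N in atTop, ∑ z ∈ T, p N 0 z < ε / (2 * (B + 1)) := by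
    exact hT0.eventually (gt_mem_nhds (by positivity))
  obtain ⟨N₀, hN₀⟩ := eventually_atTop.1 hT1
  refine ⟨N₀, fun N hN => ?_⟩
  have hnn := jumpChainProb_nonneg hq0 hq1 N (0 : Site 3)
  have hsum := hasSum_jumpChainProb hq0 hq1 N (0 : Site 3)
  have hRs : Summable fun z => p N 0 z * G (x - z) :=
    Summable.of_nonneg_of_le (fun z => mul_nonneg (hnn _) (hG0 _))
      (fun z => mul_le_mul_of_nonneg_left (hGB _) (hnn _)) (hsum.summable.mul_right B)
  have hR0 : 0 ≤ ∑' z, p N 0 z * G (x - z) := tsum_nonneg fun z => mul_nonneg (hnn _) (hG0 _)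
  rw [Real.dist_eq, sub_zero, abs_of_nonneg hR0]
  -- split the sum along `T`
  rw [← hRs.sum_add_tsum_compl (s := T)]
  have h1 : ∑ z ∈ T, p N 0 z * G (x - z) ≤ B * ∑ z ∈ T, p N 0 z := by
    rw [Finset.mul_sum]
    exact Finset.sum_le_sum fun z _ => by
      rw [mul_comm B]; exact mul_le_mul_of_nonneg_left (hGB _) (hnn _)
  have h2 : ∑' z : ((T : Set (Site 3))ᶜ : Set (Site 3)), p N 0 (z : Site 3) * G (x - z) ≤ ε / 2 := by
    have hle : ∀ z : ((T : Set (Site 3))ᶜ : Set (Site 3)),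
        p N 0 (z : Site 3) * G (x - z) ≤ p N 0 (z : Site 3) * (ε / 2) := by
      intro z
      refine mul_le_mul_of_nonneg_left (le_of_lt ?_) (hnn _)
      have hz : (z : Site 3) ∉ T := fun h => z.2 (Finset.mem_coe.2 h)
      have hz' : ¬ (ε / 2 ≤ G (x - z)) := fun h => hz (hfin.mem_toFinset.2 h)
      exact not_le.1 hz'
    calc ∑' z : ((T : Set (Site 3))ᶜ : Set (Site 3)), p N 0 (z : Site 3) * G (x - z)
        ≤ ∑' z : ((T : Set (Site 3))ᶜ : Set (Site 3)), p N 0 (z : Site 3) * (ε / 2) :=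
          (hRs.subtype _).tsum_le_tsum hle ((hsum.summable.mul_right _).subtype _)
      _ = (∑' z : ((T : Set (Site 3))ᶜ : Set (Site 3)), p N 0 (z : Site 3)) * (ε / 2) :=
          tsum_mul_right
      _ ≤ 1 * (ε / 2) := by
          refine mul_le_mul_of_nonneg_right ?_ (half_pos hε).le
          calc ∑' z : ((T : Set (Site 3))ᶜ : Set (Site 3)), p N 0 (z : Site 3) ≤ ∑' z, p N 0 z :=
                Summable.tsum_subtype_le (fun z => p N 0 z) _ (fun z => hnn z) hsum.summable
            _ = 1 := hsum.tsum_eq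
      _ = ε / 2 := one_mul _
  have h3 : B * ∑ z ∈ T, p N 0 z < ε / 2 := by
    have hlt := hN₀ N hN
    calc B * ∑ z ∈ T, p N 0 z ≤ (B + 1) * ∑ z ∈ T, p N 0 z :=
          mul_le_mul_of_nonneg_right (by linarith) (Finset.sum_nonneg fun z _ => hnn z)
      _ < (B + 1) * (ε / (2 * (B + 1))) := mul_lt_mul_of_pos_left hlt (by linarith)
      _ = ε / 2 := by field_simp
  linarith

/-- **The bridge.** A bounded nonnegative solution of the renewal identity that vanishes at
infinity is `A⁻¹` times the Green function of the (transient) walk. -/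
theorem eq_green_of_renewal (hq0 : ∀ x, 0 ≤ q x) (hq1 : HasSum q 1) {G : Site 3 → ℝ} {A B : ℝ}
    (hG0 : ∀ x, 0 ≤ G x) (hGB : ∀ x, G x ≤ B) (hGinf : Tendsto G cofinite (𝓝 0))
    (hid : ∀ z, G z = A⁻¹ * (if z = 0 then 1 else 0) + ∑' y, q y * G (z - y))
    (htrans : ∀ z, Summable fun n => jumpChainProb (fun a b => q (b - a)) n 0 z) (x : Site 3) :
    G x = A⁻¹ * ∑' n, jumpChainProb (fun a b => q (b - a)) n 0 x := by
  set p := jumpChainProb (fun a b => q (b - a)) with hp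
  have h1 : Tendsto (fun N => A⁻¹ * ∑ n ∈ Finset.range N, p n 0 x +
      ∑' z, p N 0 z * G (x - z)) atTop (𝓝 (A⁻¹ * ∑' n, p n 0 x + 0)) :=
    (((htrans x).hasSum.tendsto_sum_nat).const_mul A⁻¹).add
      (renewal_remainder_tendsto_zero hq0 hq1 hG0 hGB hGinf
        (fun z => (htrans z).tendsto_atTop_zero) x)
  have h2 : Tendsto (fun _ : ℕ => G x) atTop (𝓝 (A⁻¹ * ∑' n, p n 0 x + 0)) := by
    refine h1.congr fun N => ?_
    exact (renewal_iterate hq0 hq1 hG0 hGB hid N x).symm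
  have := tendsto_nhds_unique h2 tendsto_const_nhds
  rw [← this, add_zero]

end Summit.CriticalPhenomena.Ising3DConformalLimit.Theorems.SpineGlue
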